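import Mathlib
import HarnessLib
import Summits.ResolutionOfSingularities.ResolutionOfSingularities.Theorems.WildQuotientsWildQuotientResolutionS1aModelNodePrincipal

/-!
# S1a — A PRINCIPAL CENTRE FROM A NODE CHART OF POWER-CHAIN TYPE, ABSTRACT-MODEL FORM (centre = any K1′-regular homogeneous family)

[OURS · L1 W4.5c · lead-1 g15; R3 (`lines_killsIn_two`): the components of the line-arrangement class are cut out by LINEAR FORMS `ℓᵢ(x₁′, x₂′)`, not variables,
so the member producer ✓`exists_isPrincipalCentre_of_modelNodePowerChains` (`…S1aModelNodePrincipal`, centre = distinct variables of a free model) is restated for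
an ABSTRACT model `Φ : DW.B ≃ P` and an arbitrary centre `f : Fin c → P` with K1′ supplied as hypotheses (pattern ✓`exists_isAdmissibleCentre_of_node`)] — NOT
statements of the manuscript; counted 0; AI-level work, weaker than expert review. Crux stmt-ResolutionOfSingularities-17941 `CyclicQuotientFourfolds`, line
`s1a-logminvertex` v13 (`stub_reachLowerInFX`).

* ★★ `exists_isPrincipalCentre_of_nodePowerChains` — `M` separated, `W` a stable affine chart with node `DW`, `Φ : DW.B ≃+* P`; a homogeneous centre `f` (`c > 0`,
  weights `w > 0`, degrees `δ`), K1′ (`hK1`, `hK1'`), Veronese-normalised at the GIVEN degree `d`; `conj Φ σ` (a′)_sh-admissible for `β`, isolated, of POWER-CHAIN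
  TYPE; the degree-`d` trace zero set closed inside `W`. Then a PRINCIPAL centre `J` of degree `d` with `W` a principal-centre chart, `supp J_d` inside the closure
  of the trace zero set, and the trace formula on `W` — verbatim the proof of the free-model form with K1′ as input.
-/

set_option linter.dupNamespace false

noncomputable section

open CategoryTheory Limits AlgebraicGeometry TopologicalSpace Topology Opposite
open Literature.AlgebraicGeometry.Resolution Literature.AlgebraicGeometry.RelativeSpec
open Summit.ResolutionOfSingularities.ResolutionOfSingularities.Theorems.WildQuotientResolution.S1
open Summit.ResolutionOfSingularities.ResolutionOfSingularities.Theorems.WildQuotientResolution.S1.NodeAtlas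
open Summit.ResolutionOfSingularities.ResolutionOfSingularities.Theorems.WildQuotientResolution.S1.ProducerStep
open Summit.ResolutionOfSingularities.ResolutionOfSingularities.Theorems.WildQuotientResolution.S1.CoarseChart
open Summit.ResolutionOfSingularities.ResolutionOfSingularities.Theorems.WildQuotientResolution.S1.ChartData
open Summit.ResolutionOfSingularities.ResolutionOfSingularities.Theorems.WildQuotientResolution.S1.GoodCharts
open Summit.ResolutionOfSingularities.ResolutionOfSingularities.Theorems.WildQuotientResolution.S1.KillableTransport
open Summit.ResolutionOfSingularities.ResolutionOfSingularities.Theorems.WildQuotientResolution.S1.NodeTransport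
open Summit.ResolutionOfSingularities.ResolutionOfSingularities.Theorems.WildQuotientResolution.S1.NpFrame
open Summit.ResolutionOfSingularities.ResolutionOfSingularities.Theorems.WildQuotientResolution.S1.KillCert
open Summit.ResolutionOfSingularities.ResolutionOfSingularities.Theorems.WildQuotientResolution.S1.ModelNode
open Summit.ResolutionOfSingularities.ResolutionOfSingularities.Theorems.WildQuotientResolution.S1.ExtendRees
open Summit.ResolutionOfSingularities.ResolutionOfSingularities.Theorems.WildQuotientResolution.S1.KillGlue

namespace Summit.ResolutionOfSingularities.ResolutionOfSingularities.Theorems.WildQuotientResolution.S1.GameFrame.GModel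

variable {p : ℕ} {X' X₁ : Scheme.{0}} {q : X' ⟶ X₁} {G : Type} [Group G] {ρ : G →* Aut X'} {g₀ : G}

/-- ★★ **A PRINCIPAL CENTRE FROM A NODE CHART OF POWER-CHAIN TYPE, abstract-model form.** See the module docstring.
[OURS · L1 W4.5c · R3 member producer for non-variable centres; NOT a statement of the manuscript] -/
theorem exists_isPrincipalCentre_of_nodePowerChains [Finite G] (hG : ∀ g : G, g ∈ Subgroup.zpowers g₀) (M : GModel p q G ρ g₀)
    [M.V.IsSeparated] (W : M.act.StableAffineOpens) (DW : NodeData p M.act g₀ W)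
    {P : Type} [CommRing P] (Φ : letI := DW.instCommRing; DW.B ≃+* P)
    {c : ℕ} (hc : 0 < c) (f : Fin c → P) (δ : Fin c → Π j : Fin DW.m, ZMod (DW.r j)) (w : Fin c → ℕ) (hw : ∀ i, 0 < w i)
    (hdeg : ∀ i, letI := DW.instCommRing; letI := DW.instGradedRing; f i ∈ mapGrading DW.𝒜 Φ (δ i))
    (hK1 : RingTheory.Sequence.IsRegular P (List.ofFn f)) (hK1' : IsRegularRing (P ⧸ Ideal.span (Set.range f)))
    (d : ℕ) (hd : 0 < d)
    (hver : letI := DW.instCommRing; letI := DW.instGradedRing; letI := mapGradedRing DW.𝒜 Φ; VeroneseNormalised (mapGrading DW.𝒜 Φ) f w d)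
    (β : P) (sh : ℕ)
    (hadm : letI := DW.instCommRing; ∀ (n : ℕ) (z : P), z ∈ (weightedFiltration f w).ideal n →
      conj Φ DW.σ z - z ∈ Ideal.span {β} * (weightedFiltration f w).ideal (n + sh))
    (hiso : letI := DW.instCommRing; ∃ N : ℕ, Ideal.span (Set.range f) ^ N ≤ (augmentationIdeal (conj Φ DW.σ)).colon (Ideal.span {β}))
    (hchain : letI := DW.instCommRing; ∀ i, ∃ (mm : ℕ) (u hunit : P), 0 < mm ∧ sh ≤ mm * w i ∧ IsUnit hunit ∧
      u ∈ (weightedFiltration f w).ideal (mm * w i - sh) ∧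
      conj Φ DW.σ u - u - β * hunit * f i ^ mm ∈ Ideal.span {β} * (weightedFiltration f w).ideal (mm * w i + 1))
    (hcl : letI := DW.instCommRing; letI := DW.instGradedRing; letI := mapGradedRing DW.𝒜 Φ;
      closure (M.V.zeroLocus (U := W.1)
          ((((traceFiltration (mapGrading DW.𝒜 Φ) f w).ideal d).comap
              ((DW.e.trans (zeroRingEquiv DW.𝒜 Φ) : Γ(M.V, W.1) ≃+* ↥(mapGrading DW.𝒜 Φ 0)) : Γ(M.V, W.1) →+* ↥(mapGrading DW.𝒜 Φ 0)) :
            Ideal Γ(M.V, W.1)) : Set Γ(M.V, W.1)) ∩ (W.1 : Set M.V)) ⊆ (W.1 : Set M.V)) :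
    letI := DW.instCommRing; letI := DW.instGradedRing; letI := mapGradedRing DW.𝒜 Φ
    ∃ J : ReesFiltration M.V, IsPrincipalCentre p M.act g₀ J d ∧ IsPrincipalCentreChart p M.act g₀ J d W ∧
      (((J.ideal d).support : Set M.V)) ⊆ closure (M.V.zeroLocus (U := W.1)
          ((((traceFiltration (mapGrading DW.𝒜 Φ) f w).ideal d).comap
              ((DW.e.trans (zeroRingEquiv DW.𝒜 Φ) : Γ(M.V, W.1) ≃+* ↥(mapGrading DW.𝒜 Φ 0)) : Γ(M.V, W.1) →+* ↥(mapGrading DW.𝒜 Φ 0)) :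
            Ideal Γ(M.V, W.1)) : Set Γ(M.V, W.1)) ∩ (W.1 : Set M.V)) ∧
      ∀ n, (J.filtration ⟨W.1, DW.affine⟩).ideal n =
        ((traceFiltration (mapGrading DW.𝒜 Φ) f w).ideal n).comap
          ((DW.e.trans (zeroRingEquiv DW.𝒜 Φ) : Γ(M.V, W.1) ≃+* ↥(mapGrading DW.𝒜 Φ 0)) : Γ(M.V, W.1) →+* ↥(mapGrading DW.𝒜 Φ 0)) := by
  classical
  letI := DW.instCommRing
  letI := DW.instGradedRing
  letI := mapGradedRing DW.𝒜 Φ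
  haveI : IsLocallyNoetherian M.V := M.isLocallyNoetherian
  set eL : Γ(M.V, W.1) ≃+* ↥(mapGrading DW.𝒜 Φ 0) := DW.e.trans (zeroRingEquiv DW.𝒜 Φ) with heL
  -- the transported node
  have htame : IsTameNode p P (mapGrading DW.𝒜 Φ) (conj Φ DW.σ) := isTameNode_map DW.𝒜 Φ p DW.σ DW.tame
  have hσ : ∀ t : Γ(M.V, W.1), ((eL ((M.act.aut g₀⁻¹).hom.appLE W.1 W.1 (W.2.1 g₀⁻¹).ge t) : ↥(mapGrading DW.𝒜 Φ 0)) : P) =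
      conj Φ DW.σ ((eL t : ↥(mapGrading DW.𝒜 Φ 0)) : P) := fun t => by
    change Φ ((DW.e (actO M.act W g₀ t) : ↥(DW.𝒜 0)) : DW.B) = Φ (DW.σ (Φ.symm (Φ ((DW.e t : ↥(DW.𝒜 0)) : DW.B))))
    rw [DW.intertwine t, Φ.symm_apply_apply]
  have hσJ : ∀ n : ℕ, ((weightedFiltration f w).ideal n).map (conj Φ DW.σ : P →+* P) ≤ (weightedFiltration f w).ideal n :=
    map_le_of_admissible_shift f w (conj Φ DW.σ) sh β hadm
  -- the kill clause on every σ-fixed chart, from the power-chain certificate (KC1′)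
  have hkill : ∀ (hp' : 0 < p) (hσp' : ∀ x : P, (⇑(conj Φ DW.σ))^[p] x = x) (d' : ℕ) (b : ↥(mapGrading DW.𝒜 Φ 0))
      (hb : b ∈ (traceFiltration (mapGrading DW.𝒜 Φ) f w).ideal d') (hσb : conj Φ DW.σ (b : P) = b), 0 < d' →
      (augmentationIdeal (sigmaChart (mapGrading DW.𝒜 Φ) f w d' b hb (conj Φ DW.σ) hσJ hp' hσp' hσb)).IsPrincipal :=
    fun hp' hσp' d' b hb hσb hd' =>
      isPrincipal_augmentationIdeal_sigmaChart_of_cert f w (conj Φ DW.σ) hσJ hp' hσp' (mapGrading DW.𝒜 Φ) hd' b hb hσb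
        (cobordantKillCert_of_powerChains_shift f w (conj Φ DW.σ) hσJ hp' hσp' sh β hadm hiso hchain)
  -- the chart filtration of the trace: `W` is a principal-centre chart for it
  let K : IdealFiltration Γ(M.V, W.1) := (traceFiltration (mapGrading DW.𝒜 Φ) f w).comap (eL : Γ(M.V, W.1) →+* ↥(mapGrading DW.𝒜 Φ 0))
  let 𝒦₀ : ReesFiltration M.V := chartFiltration W.1 K
  have h𝒦₀O : ∀ n, (𝒦₀.filtration ⟨W.1, DW.affine⟩).ideal n =
      ((traceFiltration (mapGrading DW.𝒜 Φ) f w).ideal n).comap (eL : Γ(M.V, W.1) →+* ↥(mapGrading DW.𝒜 Φ 0)) := fun n => by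
    rw [filtration_chartFiltration W.1 DW.affine K n]; rfl
  have hprin₀ : IsPrincipalCentreChart p M.act g₀ 𝒦₀ d W :=
    ⟨DW.affine, DW.m, DW.r, P, inferInstance, mapGrading DW.𝒜 Φ, inferInstance, conj Φ DW.σ, eL, htame, hσ, c, f, δ, w, hc, hdeg, hw,
      hK1, hK1', hσJ, h𝒦₀O, hver, hkill⟩
  -- support = closure of the trace zero set, closed and inside `W`
  have hsupp : (((𝒦₀.ideal d).support : Set M.V)) = closure (M.V.zeroLocus (U := W.1) ((K.ideal d : Ideal Γ(M.V, W.1)) : Set Γ(M.V, W.1)) ∩ (W.1 : Set M.V)) :=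
    support_chartFiltration W.1 DW.affine K d
  obtain ⟨J, hJ, hJsupp, hJW, hJfil⟩ := exists_isPrincipalCentre_of_agree_filtration_eq hG M (ι := Unit) (fun _ => W) (fun _ => DW.affine) (fun _ => 𝒦₀) hd
    (fun _ => hprin₀) (fun _ _ _ _ _ _ => rfl)
    (B := closure (M.V.zeroLocus (U := W.1) ((K.ideal d : Ideal Γ(M.V, W.1)) : Set Γ(M.V, W.1)) ∩ (W.1 : Set M.V))) isClosed_closure
    (by rw [Set.iUnion_const]; exact hcl) (fun _ => by rw [hsupp]; exact Set.inter_subset_left)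
  exact ⟨J, hJ, hJW (), hJsupp, fun n => by rw [hJfil () n, h𝒦₀O]⟩

end Summit.ResolutionOfSingularities.ResolutionOfSingularities.Theorems.WildQuotientResolution.S1.GameFrame.GModel

end
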